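import Summits.Ventures.LatticeQCDFlow.Scaling.EntryGraphRegimeFreeGap
import Summits.Ventures.LatticeQCDFlow.Scaling.DominatedStarRegimeFreeRelaxation

/-!
HONEST FRAMING: exact (Metropolis-corrected) sampling algorithms for lattice gauge theory; figures
of merit are autocorrelation/cost numbers at stated couplings and volumes; no continuum-physics
claim.

# EntryGraphRegimeFreeRelaxation — THE ABSOLUTE GAP, RELAXATION TIME AND MIXING CEILING OF AN EXCHANGE SCHEME ON AN ARBITRARY SWAP
# GRAPH WITH PER-ENTRY MAPS, NO REGIME: HUB EDGES LISTED `≥ c` TIMES AMONG `m`, EXACT HOT SAMPLER ⇒ EVERY EIGENVALUE `≥ −1 + (1−t)w_0`,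
# `γ⋆ ≥ p·min{ct/(3m), (1−t)w_0/(7K)}`, `t_rel ≤ 1/(p·min{…})`, `t_mix(ε) ≤ ⌈t_rel·log(1/(2ε·π̃_min))⌉` (lean-2 GEN-28, ours)

Venture-side (OURS).  Cell `lqcd-flow` (pub-lqcd), unit `pub-lqcd-lean-2-g28`, 2026-08-28.  Chapter N, file 16: `Scaling/DominatedStarRegimeFreeRelaxation`
(N4) on the arbitrary edge lists of `Scaling/EntryGraphRegimeFreeGap` (N11).  N4's Dirichlet-form ceiling `𝓔_P ≤ (2 − (1−t)w_0)‖f‖²` was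
proved for ANY `π̃`-reversible swap component, so only the gap floor and the irreducibility change — both supplied by N11.

## What is proved

* **`entryGraph_absSpectralGap_ge`** — `γ⋆ ≥ p·min{ct/(3m), (1−t)w_0/(7K)}` (edge list with distinct endpoints listing every hub edge
  `≥ c ≥ 1` times; per-entry maps; one-sided transported domination on the hub entries; exact hot sampler; reversible cold kernels;
  `0 < t < 1`, `w ≥ 0`, `Σw = 1`, `w_0 > 0`; `K ≥ 1`, `|S| ≥ 2`).
* **`entryGraph_relaxationTime_le`** — `t_rel ≤ 1/(p·min{ct/(3m), (1−t)w_0/(7K)})`.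
* **`entryGraph_mixingTime_le`** — `t_mix(ε) ≤ ⌈(1/(p·min{…}))·log(1/(2ε·π̃_min))⌉` for any `0 < π̃_min ≤ π̃`.

Reading (no numerics implied): whatever additional pairs a tempering scheme proposes and through whatever maps, its relaxation time and
its volume-logarithm mixing ceiling are those of its hub sub-law diluted to the list.  NOT CLAIMED: the `log K`/`log log` forms for general
graphs (the log-Sobolev comparison of N13 is typed for hub lists only); anything measured.  Literature grade (cell rule): OWN COMPOSITION on
N4/N11; nothing cited as a fact; no new bib keys.
-/

noncomputable section

open Finset Function Matrix
open Literature.Probability.MarkovChains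

namespace Summit.Ventures.LatticeQCDFlow.Scaling

variable {S : Type*} [Fintype S] [DecidableEq S] {K m : ℕ} {μ : Fin (K + 1) → S → ℝ} {M : Fin (K + 1) → S → S → ℝ}
  {w : Fin (K + 1) → ℝ} {t p : ℝ}

section Graph
variable (e : Fin m → Fin (K + 1) × Fin (K + 1)) (φ : Fin m → Equiv.Perm S)

/-- **`γ⋆ ≥ p·min{ct/(3m), (1−t)w_0/(7K)}` ON AN ARBITRARY SWAP GRAPH WITH PER-ENTRY MAPS, NO REGIME** (exact hot sampler). [ours] -/
theorem entryGraph_absSpectralGap_ge [Nontrivial S] (hK : 1 ≤ K) (hm : 1 ≤ m) (he : ∀ r, (e r).1 ≠ (e r).2)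
    (hμ : ∀ k x, 0 < μ k x) (hμ1 : ∀ k, ∑ u, μ k u = 1) (hM : ∀ k, IsRowStochastic (M k))
    (hMrev : ∀ k, DetailedBalance (μ k) (M k)) (hM0 : ∀ u v, M 0 u v = μ 0 v) (hw0 : ∀ k, 0 ≤ w k) (hw1 : ∑ k, w k = 1)
    (hwhot : 0 < w 0) (ht0 : 0 < t) (ht1 : t < 1) (hp : 0 < p) (hp1 : p ≤ 1)
    (hdom : ∀ (r : Fin m) (k : Fin K), e r = ((0 : Fin (K + 1)), k.succ) → ∀ u : S, p * μ k.succ (φ r u) ≤ μ 0 u)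
    {c : ℕ} (hc1 : 1 ≤ c) (hc : ∀ k : Fin K, c ≤ (univ.filter (fun r : Fin m => e r = ((0 : Fin (K + 1)), k.succ))).card) :
    p * min (c * t / (3 * m)) ((1 - t) * w 0 / (7 * K))
      ≤ absSpectralGap (fun y z : Fin (K + 1) → S => t * ptGraphSwap μ e φ y z + (1 - t) * prodKernel w M y z) := by
  have hKr : (1 : ℝ) ≤ K := by exact_mod_cast hK
  have h1t : 0 < 1 - t := by linarith
  have hgap := exactEntryGraph_spectralGap_ge e φ hK hm he hμ hμ1 hM hMrev hM0 hw0 hw1 hwhot ht0 ht1 hp hp1 hdom hc1 hc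
  have hirr0 : Literature.Probability.MarkovChains.IsIrreducible (M 0) :=
    fun u v => ⟨1, by rw [pow_one, hM0]; exact hμ 0 v⟩
  have hmin := absSpectralGap_ge_min_of_dirichletForm_le (tensorFun_pos hμ) (sum_tensorFun_eq_one μ hμ1)
    (weightedScheme_isRowStochastic (ptGraphSwap_isRowStochastic hμ) hM hw0 hw1 ht0.le ht1.le)
    (weightedScheme_detailedBalance (ptGraphSwap_detailedBalance hμ) hMrev t)
    (entryGraph_isIrreducible_of_hot e φ he (graph_hubEdge_of_mult e hc1 hc) hμ hM hirr0 hw0 hw1 hwhot ht0 ht1)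
    (h := (1 - t) * w 0)
    (fun f => dominatedStar_dirichletForm_le (ptGraphSwap_isRowStochastic hμ) (ptGraphSwap_detailedBalance hμ) ht0.le ht1.le
      hw0 hw1 hμ hμ1 hM hMrev hM0 f)
  have hle : p * min (c * t / (3 * m)) ((1 - t) * w 0 / (7 * K)) ≤ (1 - t) * w 0 := by
    have h1 : min (c * t / (3 * m)) ((1 - t) * w 0 / (7 * K)) ≤ (1 - t) * w 0 / (7 * K) := min_le_right _ _
    have h2 : (1 - t) * w 0 / (7 * K) ≤ (1 - t) * w 0 := by
      rw [div_le_iff₀ (by positivity)]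
      have : 0 ≤ (1 - t) * w 0 := by positivity
      nlinarith
    have h3 : 0 ≤ min (c * t / (3 * m)) ((1 - t) * w 0 / (7 * K)) := le_min (by positivity) (by positivity)
    calc p * min (c * t / (3 * m)) ((1 - t) * w 0 / (7 * K)) ≤ 1 * min (c * t / (3 * m)) ((1 - t) * w 0 / (7 * K)) :=
          mul_le_mul_of_nonneg_right hp1 h3
      _ ≤ (1 - t) * w 0 := by rw [one_mul]; exact h1.trans h2
  exact (le_min hgap hle).trans hmin

/-- **`t_rel ≤ 1/(p·min{ct/(3m), (1−t)w_0/(7K)})` ON AN ARBITRARY SWAP GRAPH, NO REGIME.** [ours] -/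
theorem entryGraph_relaxationTime_le [Nontrivial S] (hK : 1 ≤ K) (hm : 1 ≤ m) (he : ∀ r, (e r).1 ≠ (e r).2)
    (hμ : ∀ k x, 0 < μ k x) (hμ1 : ∀ k, ∑ u, μ k u = 1) (hM : ∀ k, IsRowStochastic (M k))
    (hMrev : ∀ k, DetailedBalance (μ k) (M k)) (hM0 : ∀ u v, M 0 u v = μ 0 v) (hw0 : ∀ k, 0 ≤ w k) (hw1 : ∑ k, w k = 1)
    (hwhot : 0 < w 0) (ht0 : 0 < t) (ht1 : t < 1) (hp : 0 < p) (hp1 : p ≤ 1)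
    (hdom : ∀ (r : Fin m) (k : Fin K), e r = ((0 : Fin (K + 1)), k.succ) → ∀ u : S, p * μ k.succ (φ r u) ≤ μ 0 u)
    {c : ℕ} (hc1 : 1 ≤ c) (hc : ∀ k : Fin K, c ≤ (univ.filter (fun r : Fin m => e r = ((0 : Fin (K + 1)), k.succ))).card) :
    relaxationTime (fun y z : Fin (K + 1) → S => t * ptGraphSwap μ e φ y z + (1 - t) * prodKernel w M y z)
      ≤ 1 / (p * min (c * t / (3 * m)) ((1 - t) * w 0 / (7 * K))) := by
  have hKr : (1 : ℝ) ≤ K := by exact_mod_cast hK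
  have hmpos : (0 : ℝ) < m := Nat.cast_pos.mpr (by omega)
  have hcpos : (0 : ℝ) < c := Nat.cast_pos.mpr (by omega)
  have h1t : 0 < 1 - t := by linarith
  have hpos : 0 < p * min (c * t / (3 * m)) ((1 - t) * w 0 / (7 * K)) := mul_pos hp (lt_min (by positivity) (by positivity))
  unfold relaxationTime
  exact one_div_le_one_div_of_le hpos
    (entryGraph_absSpectralGap_ge e φ hK hm he hμ hμ1 hM hMrev hM0 hw0 hw1 hwhot ht0 ht1 hp hp1 hdom hc1 hc)

/-- **`t_mix(ε) ≤ ⌈(1/(p·min{ct/(3m), (1−t)w_0/(7K)}))·log(1/(2ε·π̃_min))⌉` ON AN ARBITRARY SWAP GRAPH, NO REGIME** (any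
`0 < π̃_min ≤ π̃`). [ours] -/
theorem entryGraph_mixingTime_le [Nontrivial S] (hK : 1 ≤ K) (hm : 1 ≤ m) (he : ∀ r, (e r).1 ≠ (e r).2)
    (hμ : ∀ k x, 0 < μ k x) (hμ1 : ∀ k, ∑ u, μ k u = 1) (hM : ∀ k, IsRowStochastic (M k))
    (hMrev : ∀ k, DetailedBalance (μ k) (M k)) (hM0 : ∀ u v, M 0 u v = μ 0 v) (hw0 : ∀ k, 0 ≤ w k) (hw1 : ∑ k, w k = 1)
    (hwhot : 0 < w 0) (ht0 : 0 < t) (ht1 : t < 1) (hp : 0 < p) (hp1 : p ≤ 1)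
    (hdom : ∀ (r : Fin m) (k : Fin K), e r = ((0 : Fin (K + 1)), k.succ) → ∀ u : S, p * μ k.succ (φ r u) ≤ μ 0 u)
    {c : ℕ} (hc1 : 1 ≤ c) (hc : ∀ k : Fin K, c ≤ (univ.filter (fun r : Fin m => e r = ((0 : Fin (K + 1)), k.succ))).card)
    {πmin : ℝ} (hmin0 : 0 < πmin) (hmin : ∀ x, πmin ≤ tensorFun μ x) {ε : ℝ} (hε : 0 < ε) :
    mixingTime (fun y z : Fin (K + 1) → S => t * ptGraphSwap μ e φ y z + (1 - t) * prodKernel w M y z) (tensorFun μ) ε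
      ≤ ⌈1 / (p * min (c * t / (3 * m)) ((1 - t) * w 0 / (7 * K))) * Real.log (1 / (2 * ε * πmin))⌉₊ := by
  have hKr : (1 : ℝ) ≤ K := by exact_mod_cast hK
  have hmpos : (0 : ℝ) < m := Nat.cast_pos.mpr (by omega)
  have hcpos : (0 : ℝ) < c := Nat.cast_pos.mpr (by omega)
  have h1t : 0 < 1 - t := by linarith
  have hpos : 0 < p * min (c * t / (3 * m)) ((1 - t) * w 0 / (7 * K)) := mul_pos hp (lt_min (by positivity) (by positivity))
  have hgap := entryGraph_absSpectralGap_ge e φ hK hm he hμ hμ1 hM hMrev hM0 hw0 hw1 hwhot ht0 ht1 hp hp1 hdom hc1 hc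
  have hrel := entryGraph_relaxationTime_le e φ hK hm he hμ hμ1 hM hMrev hM0 hw0 hw1 hwhot ht0 ht1 hp hp1 hdom hc1 hc
  have hirr0 : Literature.Probability.MarkovChains.IsIrreducible (M 0) :=
    fun u v => ⟨1, by rw [pow_one, hM0]; exact hμ 0 v⟩
  have hlam : lambdaStar (fun y z : Fin (K + 1) → S => t * ptGraphSwap μ e φ y z + (1 - t) * prodKernel w M y z) < 1 := by
    unfold absSpectralGap at hgap; linarith
  have hT := LevinPeres2017_thm_12_4 (tensorFun_pos hμ) (sum_tensorFun_eq_one μ hμ1)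
    (weightedScheme_isRowStochastic (ptGraphSwap_isRowStochastic hμ) hM hw0 hw1 ht0.le ht1.le)
    (weightedScheme_detailedBalance (ptGraphSwap_detailedBalance hμ) hMrev t)
    (entryGraph_isIrreducible_of_hot e φ he (graph_hubEdge_of_mult e hc1 hc) hμ hM hirr0 hw0 hw1 hwhot ht0 ht1) hlam hmin0 hmin hε
  by_cases hL : 0 ≤ Real.log (1 / (2 * ε * πmin))
  · exact hT.trans (Nat.ceil_mono (mul_le_mul_of_nonneg_right hrel hL))
  · push Not at hL
    have hrel0 : 0 ≤ relaxationTime (fun y z : Fin (K + 1) → S => t * ptGraphSwap μ e φ y z + (1 - t) * prodKernel w M y z) := by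
      unfold relaxationTime
      exact div_nonneg zero_le_one (le_trans hpos.le hgap)
    have h0 : ⌈relaxationTime (fun y z : Fin (K + 1) → S => t * ptGraphSwap μ e φ y z + (1 - t) * prodKernel w M y z)
        * Real.log (1 / (2 * ε * πmin))⌉₊ = 0 :=
      Nat.ceil_eq_zero.mpr (mul_nonpos_of_nonneg_of_nonpos hrel0 hL.le)
    rw [h0] at hT
    exact hT.trans (Nat.zero_le _)

end Graph

end Summit.Ventures.LatticeQCDFlow.Scaling

end
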